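import Summits.BirchSwinnertonDyer.Rank1Residual.F1Sign2.OddTamagawaSpinLawAtTwo
import HarnessLib.Audit.Tags
import HarnessLib

/-!
# DESC-39 «THE LEVEL-0 COUNTING LAW» — point-free Néron cells, both directions, typed over the tree's Kodaira / Tamagawa carriers (-desc g29, MEMO-desc §39; typer -ty g20)

PORT (typer -ty g20, cell bsd-f1-sign2) of -desc g29's `MEMO-desc-data/g29/lean/Sketch39_byname.lean` d9baf02caa7087e5 — the by-name variant of the REF1-audited
`Sketch39.lean` 0c15bc8a9f95bb30 (identical except that it imports the DESC-38 module `OddTamagawaSpinLawAtTwo.lean` — in the tree since p743674 — and states the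
DESC-38 bridge BY NAME, `pureSpinLawOfOddTamagawa_of_switchedOff : PureSpinLawOfSwitchedOffReductionAtTwo → (∀ W, finiteness) → PureSpinLawOfOddTamagawaAtTwo`, using the
tree's `odd_tamagawaNumberAt_of_odd_tamagawaProduct` instead of a primed restatement; the builder asserts that every `def` block is byte-identical in the two files).
VOCABULARY (`def`s with parameters): `IsAdicSquare D ℓ`, `QuadUnramifiedAt D ℓ`, `ThreeLocalRootsC c ℓ`, `OneLocalRootC c ℓ`, `RamifiedPairC c ℓ`, `PlaceOver v ℓ`, the
point-free cells `SwitchedOffAt W c v ℓ` / `SwitchedOnAt W c v ℓ` (THM 39.1); ROWS (`@[conjecture]`, theorem-candidates modulo the LAW36′ dictionary of DESC-36-E exactly as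
-desc labels them): **DESC-39-A** `PureSpinLawOfSwitchedOffReductionAtTwo`, **DESC-39-B** `SpinObstructedOfTwoSwitchedOnPlacesAtTwo`, **DESC-39-C**
`PureSpinLawOfLoneTwoEvenConductorAtTwo`, **DESC-39-D** `SpinObstructedOfOddMultiplicativeTwoModFourAtTwo`; planner glue `switchedOffAt_of_odd`, `switchedOffAt_of_noRoot`,
`switchedOnAt_of_odd_place`, `pureSpinLawOfOddTamagawa_of_switchedOff` (DESC-39-A ⟹ DESC-38-A), `two_not_mem_of_placeOver`, `pureSpinLawOfLoneEvenConductor_of_lone39`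
(DESC-39-C ⟹ DESC-37-B), `shapeWitness_nil_of_switchedOff` (⊂ DESC-36-E with `ys = []`), `not_switchedOn_of_all_off` — all VERBATIM; -desc's sanity `example`s and REF1's
probes go to the kernel sibling `LevelZeroSpinLawAtTwoKernel.lean`.  RIDER R253a (REF1 §253, «to -desc / -ty before the port»): APPLIED (`0 < n ∧` inserted in the `I n` clause of `SwitchedOffAt` — the ONLY non-verbatim token of this port).

PORT GATE = REF1-AUDIT §253 (-ref1 g22, 2026-08-29T21:19:19Z; `REF1-data/b253/`: Probe253.lean 48d35c4d9829cc5b = verbatim copy + 7 probes, rc 0 / 0 warnings / 0 sorries;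
fold253.py c61f…/fold253.out): **all four rows SURVIVE** (conjecture-grade, theorem-candidates modulo LAW36′ as labelled; elaborate; non-vacuous — the carriers are REAL tree
definitions: `kodairaSymbolAt` = Tate's algorithm on the completion, `tamagawaNumberAt` = `localTamagawaNumber`, `HasGood/Multiplicative/SplitMultiplicativeReductionAt`;
census-exact under an INDEPENDENT ENGINE from the minimal a-invariants: `d_v` 0/588, unramified flag 0/460, `n`/split/`c` at multiplicative places 0/369 mismatches vs P39;
cells vs `u` 0 violations / 507; T3 78/78 (3 263 primes), T4 10/10, T6 52/52 (2 235), T10 24/24); THM 39.1 = corollary of print at odd places (Česnavičius 2016 Prop. 2.5 (a)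
index) + THM 38.2 at `2` — concur; THM 39.2 / LEMMA 39.3 / COR 39.4 short and correct in the §37 framework.  Riders: **R253a** (hygiene — see above), **R253b** (to -desc g30:
at a LONE place `2` with `d₂ = 2` the element 𝔯-bit is undefined; the generic carrier `ConductorOddAbove F ℓ` of OPEN (b) must be the IDEAL version, with a stated lemma of
agreement with the Hensel carrier at `d = 1`), **R253c** (data, cheap: the 10 UNDECIDED rows at `2` — III ×3, III* ×5, I₃* c4, I₀* c2 — are 9× `u = 1` / 1× `u = 0`; a targeted
ENGINE-39 run on additive-at-2, `c₂`-even curves is the one place where the point-free programme can still fail; 39-A/39-C are silent there by construction).  PARTITION: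
none; beyond-print theorem: no (agree with -desc's own label); bears_on stmt-BirchSwinnertonDyer-23715 (binder `Odd W.tamagawaProduct` ⟹ every place OFF ⟹ 39-A restricts
to DESC-38-A; 39-B/39-D say what the binder buys).

REF2 PLACEMENT — RIDER R58h (-ref2 g58, 2026-08-29T21:21:01Z): **the LEVEL-0 framework of §37–§39 has a PRINT HOME** — the «`M₁ ⊂ Sel₂(E) ⊂ M₂` / nice-at-`v`» sandwich of
Brumer–Kramer 1977 (Case 1, §7) [cite: BrumerKramer1977, §7] → Li 2019 [cite: Li2019SelmerClassGroups, Thm. 1.1] (`K = ℚ`, disc `F` negative squarefree ⟹ `C_L[2] ≅ M₁′ ⊂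
Sel₂(E/ℚ) ⊂ M₂′`, index 2) → Barrera Salazar–Pacetti–Tornaría 2021 (arXiv 2001.02263, the bound `dim Cl_*(A_K,E)[2] ≤ dim Sel₂(E) ≤ dim Cl_*(A_K,E)[2] + [K:ℚ]`) → Yoo–Yu 2022
(arXiv 2005.00194: `M_{1,v}` = unramified classes, `M_{2,v}` = even-valuation classes, equal at every odd `v`; Def 1.5 «`E` is NICE at `v`» :⟺ `M_{1,v} ⊂ im δ_v ⊂ M_{2,v}`;
Thm 1.6; **Thm 1.10 (Brumer–Kramer): «for an odd prime `v`, `E` is nice at `v` if `[E(K_v) : E₀(K_v)]` is odd» = THM 38.1 verbatim**; Prop 1.9; Thm 1.11 (even `v`); their open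
question p. 4 «find examples of `E` NOT nice at `v`»).  DICTIONARY: at odd `v` the switch `u_v = 0` ⟺ «`E` nice at `v`»; `S_on` = the set of non-nice places; the OFF-rows of
THM 38.2/39.1 = niceness criteria (BK77 `c_v` odd; Česnavičius 2.5 (a) index; Y–Y 1.9/1.11); the ON-rows (`I_n*` `c_v = 2` cells, non-split `4 ∣ n`, III/III*,
multiplicative-at-2 with `v(D)` even) = ANSWERS to Y–Y's open question, i.e. beyond their print; the unit rescue by the norm-one class `ε⁺` (`Δ_L < 0`) = the archimedean /
semi-narrow part of `M₁` vs `M₂`; THM 39.2 / LAW 39.L (a COUNTING law: one unit class absorbs at most one non-nice place) is NOT in these four papers (they assume niceness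
everywhere).  GRADES: THM 38.1 = PRINT (BK77 / Y–Y 1.10 — cite it, do not claim); THM 39.1 OFF-rows corollary-of-print; ON-rows + 2-adic cells + THM 39.2 / LAW 39.L /
DESC-39-A…D = **beyond-print extension of a print framework (NEW-COMBINATION**; the load-bearing lever «Sel₂ vs (semi-)narrow class group of `L`» IS used on this problem:
BK77, Li19, BPT21, YY22).  ASK DESC-G30-1 (to -desc g30): restate `u_v` / `U_v` / «pure vs corrected» in the `M₁/M₂`/nice vocabulary with these cites and check BPT §2 (Thms
2.11/2.16, Kodaira examples) against the ON cells before calling any 2-adic cell new.  PARTITION: THM 38.1 moves corollary-of-print → print-verbatim; nothing else moves.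

DATA (-desc g29, `MEMO-desc-data/g29/`; MEMO-desc §39 cb5b2155e4e05a4b): ENGINE 39 (g28 kit j335565, 202 curves, 588 place rows) × the cells (`an/join39.txt`): 578/588 rows
decided, 0 disagreements (odd: OFF 266 / ON 120; at 2: OFF 168 / ON 24; undecided 10); BC5 per row in the docstrings; BC7 Lean probes `bc/bc7_39_*.lean/.out`.
BSD is not proved by anything here; 23715 is not closed by anything here.
-/

noncomputable section

open scoped Classical

open WeierstrassCurve Literature.NumberTheory.EllipticCurves Literature.NumberTheory.DiophantineGeometry Polynomial IsDedekindDomain NumberField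

namespace Summit.BirchSwinnertonDyer.Rank1Residual.F1Sign2

/-! ### §39 vocabulary: local root count and pair type of the cubic datum at a prime `ℓ` -/

/-- `D` is a square in `ℤ_ℓ`: a square root modulo every power of `ℓ` (for `D ≠ 0` equivalently a square in `ℚ_ℓ`; compactness of `ℤ_ℓ`). -/
def IsAdicSquare (D : ℤ) (ℓ : ℕ) : Prop :=
  ∀ k : ℕ, ∃ x : ZMod (ℓ ^ k), x ^ 2 = (D : ZMod (ℓ ^ k))

/-- `ℚ_ℓ(√D)/ℚ_ℓ` is unramified or trivial: `v_ℓ(D)` even, and at `ℓ = 2` moreover `D = 4^k·u` with `u ≡ 1 (mod 4)`. -/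
def QuadUnramifiedAt (D : ℤ) (ℓ : ℕ) : Prop :=
  Even (padicValInt ℓ D) ∧ (ℓ = 2 → ∃ (k : ℕ) (u : ℤ), D = 4 ^ k * u ∧ u % 4 = 1)

/-- THREE local roots (`d_ℓ = 2`, `W(ℚ_ℓ)[2] ≅ (ℤ/2)²`): a root of the cubic datum `c` in `ℤ_ℓ` and `disc c` a square in `ℤ_ℓ`
(`disc c = disc(quadratic cofactor)·c'(root)²`-type identity: the cofactor then splits). -/
def ThreeLocalRootsC (c : ℤ[X]) (ℓ : ℕ) : Prop :=
  HasLocalRootC c ℓ ∧ IsAdicSquare (cubicDiscZ c) ℓ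

/-- EXACTLY ONE local root (`d_ℓ = 1`, `W(ℚ_ℓ)[2] ≅ ℤ/2`). -/
def OneLocalRootC (c : ℤ[X]) (ℓ : ℕ) : Prop :=
  HasLocalRootC c ℓ ∧ ¬ IsAdicSquare (cubicDiscZ c) ℓ

/-- One local root and the 2-torsion PAIR generates a RAMIFIED quadratic extension of `ℚ_ℓ` (`d_ℓ = 1`, `W[2](ℚ_ℓ^nr) ≅ ℤ/2`). -/
def RamifiedPairC (c : ℤ[X]) (ℓ : ℕ) : Prop :=
  OneLocalRootC c ℓ ∧ ¬ QuadUnramifiedAt (cubicDiscZ c) ℓ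

/-- The finite place `v` of `ℚ` lies over the rational prime `ℓ`. -/
def PlaceOver (v : HeightOneSpectrum (𝓞 ℚ)) (ℓ : ℕ) : Prop :=
  ℓ.Prime ∧ (ℓ : 𝓞 ℚ) ∈ v.asIdeal

/-! ### §39 the point-free LEVEL-0 cells (THM 39.1) -/

/-- **SWITCHED OFF at `v ∣ ℓ` (point-free cell; THM 39.1 / THM 38.2).**  `H¹_nr(ℚ_v, W[2]) ⊂ δ(W(ℚ_v))` is FORCED by: good reduction; or `c_v` odd (THM 38.1);
or no local root (`H¹_nr = 0`, `dim H¹_nr = d_v`); or type `I_n` with (non-split and `4 ∣ n`: the pair `±√q` sits on component `n/2 ∈ 2Φ = (F−1)Φ`) or with the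
pair ramified (`W[2](ℚ_v^nr) = ⟨T_{−1}⟩ ⊂ W⁰`, Tate); or type `I_n*` with `c_v = 2` and (`n` odd: `Φ(k̄) = ℤ/4`, `F = −1`, `Φ[2] = 2Φ`; or three roots / ramified
pair: `c̄(W[2](ℚ_v^nr)) = c̄(W[2](ℚ_v)) ⊂ Φ(k) = (F−1)Φ` for the transvection).
(RIDER, typer -ty g20: REF1-AUDIT §253 A2 reading + **R253a APPLIED** — the `I n` clause carries `0 < n` so that the multiplicative cell is syntactically what THM 39.1 (ii)
proves (REF1 P2: -desc's clause also fired at `n = 0`, `KodairaSymbol.I 0` = good reduction, `4 ∣ 0` — harmless because «good» is the first disjunct, but not restricted to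
multiplicative places; no census effect); every other token VERBATIM.  REF2 R58h: at odd `v` «switched off» ⟺ «`E` NICE at `v`» in the Brumer–Kramer / Yoo–Yu vocabulary
(`M_{1,v} ⊂ im δ_v ⊂ M_{2,v}`); the `Odd (W.tamagawaNumberAt v)` disjunct = THM 38.1 = Yoo–Yu Thm 1.10 (Brumer–Kramer) IN PRINT.) -/
def SwitchedOffAt (W : WeierstrassCurve ℚ) (c : ℤ[X]) (v : HeightOneSpectrum (𝓞 ℚ)) (ℓ : ℕ) : Prop :=
  W.HasGoodReductionAt v ∨ Odd (W.tamagawaNumberAt v) ∨ ¬ HasLocalRootC c ℓ ∨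
    (∃ n : ℕ, 0 < n ∧ W.kodairaSymbolAt v = KodairaSymbol.I n ∧ ((¬ W.HasSplitMultiplicativeReductionAt v ∧ 4 ∣ n) ∨ RamifiedPairC c ℓ)) ∨
    (∃ n : ℕ, W.kodairaSymbolAt v = KodairaSymbol.Istar n ∧ W.tamagawaNumberAt v = 2 ∧ (Odd n ∨ ThreeLocalRootsC c ℓ ∨ RamifiedPairC c ℓ))

/-- **SWITCHED ON at `v ∣ ℓ` (point-free sufficient cell; THM 39.1).**  Not switched off, and `v` odd or multiplicative: then `H¹_nr ⊄ δ(W(ℚ_v))` is FORCED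
(odd additive: the component map `c̄` is injective on `W[2](ℚ_v^nr)` because `W⁰(ℚ_v^nr)` is 2-torsion-free; multiplicative: the unramified pair `±√q` has
component `n/2 ∉ (F−1)Φ`).  The complement «additive at 2, `c₂` even, a local root, not an `I_n*`-`c₂ = 2` decided cell» is point-dependent (TIER 2). -/
def SwitchedOnAt (W : WeierstrassCurve ℚ) (c : ℤ[X]) (v : HeightOneSpectrum (𝓞 ℚ)) (ℓ : ℕ) : Prop :=
  ¬ SwitchedOffAt W c v ℓ ∧ (ℓ ≠ 2 ∨ W.HasMultiplicativeReductionAt v)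

/-! ### §39 rows -/

/-- **DESC-39-A `PureSpinLawOfSwitchedOffReductionAtTwo` (THE LEVEL-0 LAW, harmless direction; `@[conjecture]`, theorem-candidate modulo LAW36′; MEMO-desc §39.3).**
Setting of LAW36 (`CubicDatumFor`, `Sel₂(W) = 0`, degree-one primes of odd class order).  If EVERY bad place is switched off (point-free cell) then the PURE
`S₃`-spin law fits with the empty correction list.  Mechanism: `u_v = 0` everywhere (THM 39.1) ⟹ every LAW36′ cofactor has even valuations (P37.1, Poitou–Tate)
⟹ unit·□ (odd class number) ⟹ the correction parity vanishes.  Supersedes DESC-38-A (odd Tamagawa product ⟹ every cell OFF, glue `pureSpinLawOfOddTamagawa_of_switchedOff`)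
and g28's TIER 1 (adds multiplicative `2` with ramified pair).  BC5 (an/join39.txt T3): 78 census curves satisfy the hypothesis, **78/78 pure** (3 263 pure
primes, 0 runs with `ys ≠ []`), 40 of them with EVEN Tamagawa product, 11 beyond g28's TIER 1.  Why it might fail: only through LAW36′ (dictionary «support of
the correction = switched-on places») or even `h_L` (excluded); a mis-typed OFF cell would show as a `u_v = 1` row of ENGINE 39 inside the cell (0/434).
(RIDER, typer -ty g20: `@[conjecture]`, conjecture-grade, theorem-candidate modulo LAW36′ as labelled.  REF1-AUDIT §253: **SURVIVES** (non-vacuous; T3 re-derived by an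
independent engine from the minimal a-invariants: 78/78 pure, 3 263 pure primes; cells vs ENGINE 39's `u` 0 violations / 507).  REF2 R58h: the OFF-rows are niceness
criteria in print (BK77 `c_v` odd; Česnavičius 2016 Prop. 2.5 (a) index; Yoo–Yu Prop 1.9 / Thm 1.11) ⟹ this row = the «nice everywhere ⟹ `M₁`-side» half of a PRINT FRAMEWORK
pushed to the spin law through LAW36′: NEW-COMBINATION, corollary-of-print in its local inputs.  Kernel/glue: `pureSpinLawOfOddTamagawa_of_switchedOff` (⟹ DESC-38-A, given
finiteness of the Tamagawa support), `shapeWitness_nil_of_switchedOff` (⊂ DESC-36-E, `ys = []`).) -/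
@[conjecture] def PureSpinLawOfSwitchedOffReductionAtTwo : Prop :=
  ∀ (W : WeierstrassCurve ℚ) [W.IsElliptic] [W.IsGloballyMinimal],
    ∀ (c xnum : ℤ[X]) (xden : ℕ), CubicDatumFor W c xnum xden →
      selmerTwoCard W = 1 → DegOnePrimesOddClassC c →
        (∀ (v : HeightOneSpectrum (𝓞 ℚ)) (ℓ : ℕ), PlaceOver v ℓ → SwitchedOffAt W c v ℓ) →
          CorrectedSpinLawFits W c xnum xden []

/-- **DESC-39-B `SpinObstructedOfTwoSwitchedOnPlacesAtTwo` (THE COUNTING LAW, visible direction; `@[conjecture]`, theorem-candidate modulo LAW36′; MEMO-desc §39.3).**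
Same setting, COMPLEX cubic field (`disc c < 0`: one norm-one unit class `ε⁺`).  If two DISTINCT places are switched on (point-free cells) then the pure law
FAILS (`ys = []` does not fit).  Mechanism (THM 39.2): `Sel₂(W) = 0` makes the failure set `F(ε⁺)` non-empty and it equals `{v}` for at most one place, so at
least one switched-on place `v` has no rescuing unit, `U_v = 0`, `r_v = rank val_v|𝒲_v ≥ 1` (THM 37.1 (b), any `d_v ≥ 1`): VISIBLE ⟹ a correction class
supported above `v` (LAW36′) ⟹ some pure split prime violates the pure law (Chebotarev supply).  Generalises PROP 37.4 / THM 37.5 (cell X) from «two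
`𝔯`-even `d = 1` places» to any two switched-on places; no `𝔯`-bit, no Hensel datum.  BC5 (an/join39.txt T4): the 10 census curves with `Δ_L < 0` and two ON
places are **10/10 corrected** (`ys ∈ {[z=y·y'], [y,y']}`), and the 10 cell-X twists (two twisted `I₀*` places, ON) fail the pure law at 463/1 165 pure primes
(g27 §37.5); 0 census curves with two ON places are pure.  Why it might fail: LAW36′ dictionary / Chebotarev supply as for DESC-37-A; `Δ_L > 0` (three unit
classes, up to three rescues) is excluded on purpose.
(RIDER, typer -ty g20: `@[conjecture]`, conjecture-grade, theorem-candidate modulo LAW36′.  REF1-AUDIT §253: **SURVIVES** (THM 39.2 / LEMMA 39.3 re-derived on paper; T4 10/10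
corrected re-derived; P3: jointly unsatisfiable with DESC-39-A's hypothesis — kernel `false_of_allOff_of_twoOn`).  REF2 R58h: THE COUNTING LAW (one norm-one unit class absorbs at
most one non-nice place) is NOT in Brumer–Kramer 1977 / Li 2019 / Barrera Salazar–Pacetti–Tornaría 2021 / Yoo–Yu 2022 (they assume niceness everywhere) — **beyond-print
extension of a print framework, NEW-COMBINATION**; the ON cells answer Yoo–Yu's open question («examples of `E` not nice at `v`»).) -/
@[conjecture] def SpinObstructedOfTwoSwitchedOnPlacesAtTwo : Prop :=
  ∀ (W : WeierstrassCurve ℚ) [W.IsElliptic] [W.IsGloballyMinimal],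
    ∀ (c xnum : ℤ[X]) (xden : ℕ), CubicDatumFor W c xnum xden →
      selmerTwoCard W = 1 → DegOnePrimesOddClassC c → cubicDiscZ c < 0 →
        (∃ (v v' : HeightOneSpectrum (𝓞 ℚ)) (ℓ ℓ' : ℕ), v ≠ v' ∧ PlaceOver v ℓ ∧ PlaceOver v' ℓ' ∧ SwitchedOnAt W c v ℓ ∧ SwitchedOnAt W c v' ℓ') →
          ¬ CorrectedSpinLawFits W c xnum xden []

/-- **DESC-39-C `PureSpinLawOfLoneTwoEvenConductorAtTwo` (lone switched-on place `2`, harmless; `@[conjecture]`, theorem-candidate modulo LAW36′; MEMO-desc §39.3).**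
Same setting with the b-invariant cubic `F_W`: if every ODD bad place is switched off (point-free cell), `W(ℚ₂)[2] ≅ ℤ/2` and the conductor `𝔯` of `ℤ[Θ]` is
EVEN above `2`, the pure law fits — whatever the cell at `2` (THM 37.3: the relaxed class at `2` is then a unit with failure set `{2}` lying in `ε₂ + 𝒲₂`).
Supersedes DESC-37-B (odd `c_ℓ` at odd `ℓ` ⟹ OFF; glue `pureSpinLawOfLoneEvenConductor_of_lone39`).  BC5 (an/join39.txt T6): 52 census curves satisfy the
hypotheses (the 51 of DESC-37-B + H3090nI8n4 with a non-split `I₈` at `3`), **52/52 pure** (2 235 pure primes); among them `2` is ON for R918I12un15 and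
undecided for J2848I3s4n7 (both pure).  Why it might fail: as DESC-37-B (the «lone» hypothesis is load-bearing: cell X).
(RIDER, typer -ty g20: `@[conjecture]`, conjecture-grade, theorem-candidate modulo LAW36′; SUPERSEDES the tree row DESC-37-B `PureSpinLawOfLoneEvenConductorAtTwo`
(`ConductorBitSpinLawAtTwo.lean`, p740293) via the glue `pureSpinLawOfLoneEvenConductor_of_lone39`.  REF1-AUDIT §253: **SURVIVES** (T6 52/52 pure, 2 235 primes,
re-derived); R253b (to -desc g30): at a LONE place `2` with `d₂ = 2` the element 𝔯-bit (`ConductorOddAboveTwo`, Hensel datum) is undefined — the generic carrier of OPEN (b)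
must be the IDEAL bit.  REF2 R58h: beyond-print (2-adic cell) on a print framework.) -/
@[conjecture] def PureSpinLawOfLoneTwoEvenConductorAtTwo : Prop :=
  ∀ (W : WeierstrassCurve ℚ) [W.IsElliptic] [W.IsGloballyMinimal],
    ∀ (c xnum : ℤ[X]) (xden : ℕ) (B2 B4 B6 : ℤ), CubicDatumFor W c xnum xden → BInvariantsZ W B2 B4 B6 →
      selmerTwoCard W = 1 → DegOnePrimesOddClassC c →
        (∀ (v : HeightOneSpectrum (𝓞 ℚ)) (ℓ : ℕ), PlaceOver v ℓ → ℓ ≠ 2 → SwitchedOffAt W c v ℓ) →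
          OneTwoAdicRoot (twoDivisionCubicZ B2 B4 B6) → ¬ ConductorOddAboveTwo (twoDivisionCubicZ B2 B4 B6) →
            CorrectedSpinLawFits W c xnum xden []

/-- **DESC-39-D `SpinObstructedOfOddMultiplicativeTwoModFourAtTwo` (visible at an odd multiplicative place; `@[conjecture]`, theorem-candidate modulo LAW36′;
MEMO-desc §39.3).**  Same setting (any sign of `Δ_L`).  If some ODD place `v` has type `I_n` with `n ≡ 2 (mod 4)` and exactly one local root then the pure law
FAILS: there `c_v` is even, the cell is ON, and the conductor `𝔯` is ODD above `v` (`v_𝔔(𝔯) = n/2` at the two primes over the pair `±√q`; REF2 v56 §1.2: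
`q_v(ε_v) = [n ≡ 2 (4)]`), so `v` is visible by COR 37.2 (no sign, no lone hypothesis).  BC5 (an/join39.txt T10): 24 census curves have such a place (28 place
rows, all `𝔯`-odd), **24/24 corrected**; the 6 curves whose odd split `I_n` place has `n ≡ 0 (mod 4)` and is their only ON place are all pure (rescued).
Why it might fail: LAW36′ dictionary; at `d_v = 2` (three roots) COR 37.2's unit argument is not available (census 4/4 corrected nevertheless, excluded).
(RIDER, typer -ty g20: `@[conjecture]`, conjecture-grade, theorem-candidate modulo LAW36′ (no sign, no lone hypothesis).  REF1-AUDIT §253: **SURVIVES** (T10 24/24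
corrected, 28 place rows all 𝔯-odd, re-derived by the independent engine; `n`/split/`c` at multiplicative places 0/369 mismatches).  REF2 R58h: an ON-row (odd multiplicative
`I_n`, `n ≡ 2 (mod 4)`, one local root ⟹ not nice at `v`) — beyond Yoo–Yu's print (their Thm 1.11 covers multiplicative `v(D)` odd ⟹ nice), NEW-COMBINATION.) -/
@[conjecture] def SpinObstructedOfOddMultiplicativeTwoModFourAtTwo : Prop :=
  ∀ (W : WeierstrassCurve ℚ) [W.IsElliptic] [W.IsGloballyMinimal],
    ∀ (c xnum : ℤ[X]) (xden : ℕ), CubicDatumFor W c xnum xden →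
      selmerTwoCard W = 1 → DegOnePrimesOddClassC c →
        (∃ (v : HeightOneSpectrum (𝓞 ℚ)) (ℓ n : ℕ), PlaceOver v ℓ ∧ ℓ ≠ 2 ∧ W.kodairaSymbolAt v = KodairaSymbol.I n ∧ n % 4 = 2 ∧ OneLocalRootC c ℓ) →
          ¬ CorrectedSpinLawFits W c xnum xden []

/-! ### kernel glue -/

/-- An odd Tamagawa number switches the place off (the DESC-38-A / THM 38.1 cell is the second disjunct). -/
theorem switchedOffAt_of_odd (W : WeierstrassCurve ℚ) (c : ℤ[X]) (v : HeightOneSpectrum (𝓞 ℚ)) (ℓ : ℕ)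
    (h : Odd (W.tamagawaNumberAt v)) : SwitchedOffAt W c v ℓ :=
  Or.inr (Or.inl h)

/-- No local root (`d_v = 0`, `H¹_nr(ℚ_v, W[2]) = 0`) switches the place off. -/
theorem switchedOffAt_of_noRoot (W : WeierstrassCurve ℚ) (c : ℤ[X]) (v : HeightOneSpectrum (𝓞 ℚ)) (ℓ : ℕ)
    (h : ¬ HasLocalRootC c ℓ) : SwitchedOffAt W c v ℓ :=
  Or.inr (Or.inr (Or.inl h))

/-- At an odd place «not switched off» already is the ON cell (THM 39.1: odd places are entirely point-free). -/
theorem switchedOnAt_of_odd_place (W : WeierstrassCurve ℚ) (c : ℤ[X]) (v : HeightOneSpectrum (𝓞 ℚ)) {ℓ : ℕ}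
    (hℓ : ℓ ≠ 2) (h : ¬ SwitchedOffAt W c v ℓ) : SwitchedOnAt W c v ℓ :=
  ⟨h, Or.inl hℓ⟩

/-- **DESC-39-A supersedes DESC-38-A** (tree row `PureSpinLawOfOddTamagawaAtTwo`, `OddTamagawaSpinLawAtTwo.lean`): on the odd-Tamagawa slice (the crux binder
`Odd W.tamagawaProduct` of `RankOneAtTwoBigImageOddLocal`, verbatim) every place is switched off (second disjunct of the cell), so DESC-39-A yields DESC-38-A — given the
finiteness of the set of places with `c_v ≠ 1` (the named fact `mulSupport_localTamagawaNumber_finite`, taken as a hypothesis for every curve; the tree's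
`odd_tamagawaNumberAt_of_odd_tamagawaProduct` does the arithmetic). -/
theorem pureSpinLawOfOddTamagawa_of_switchedOff (h39 : PureSpinLawOfSwitchedOffReductionAtTwo)
    (hfin : ∀ (W : WeierstrassCurve ℚ) [W.IsElliptic], W.mulSupport_localTamagawaNumber_finite) :
    PureSpinLawOfOddTamagawaAtTwo := by
  intro W _ _ c xnum xden hc hs ho ht
  have hfin' : (Function.mulSupport fun v : HeightOneSpectrum (𝓞 ℚ) => W.tamagawaNumberAt v).Finite := hfin W
  exact h39 W c xnum xden hc hs ho
    (fun v ℓ _ => switchedOffAt_of_odd W c v ℓ (odd_tamagawaNumberAt_of_odd_tamagawaProduct W hfin' ht v))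

/-- Kernel lemma: a place over an odd prime `ℓ` is not over `2`. -/
theorem two_not_mem_of_placeOver {v : HeightOneSpectrum (𝓞 ℚ)} {ℓ : ℕ} (hv : PlaceOver v ℓ) (hℓ : ℓ ≠ 2) :
    (2 : 𝓞 ℚ) ∉ v.asIdeal := by
  intro h2
  have hcop : Nat.Coprime ℓ 2 := (Nat.coprime_primes hv.1 Nat.prime_two).2 hℓ
  have hcopZ : IsCoprime (ℓ : ℤ) (2 : ℤ) := by exact_mod_cast Nat.isCoprime_iff_coprime.mpr hcop
  obtain ⟨a, b, hab⟩ := hcopZ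
  have h1 : (1 : 𝓞 ℚ) ∈ v.asIdeal := by
    have key : ((a : 𝓞 ℚ) * (ℓ : 𝓞 ℚ) + (b : 𝓞 ℚ) * (2 : 𝓞 ℚ)) = 1 := by exact_mod_cast congrArg (Int.cast : ℤ → 𝓞 ℚ) hab
    rw [← key]
    exact v.asIdeal.add_mem (v.asIdeal.mul_mem_left _ hv.2) (v.asIdeal.mul_mem_left _ h2)
  exact v.isPrime.ne_top ((Ideal.eq_top_iff_one _).mpr h1)

/-- **DESC-39-C supersedes DESC-37-B**: odd local Tamagawa numbers at the odd places switch them off, so the §37 row's hypotheses imply the §39 row's. -/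
theorem pureSpinLawOfLoneEvenConductor_of_lone39 (h : PureSpinLawOfLoneTwoEvenConductorAtTwo) :
    PureSpinLawOfLoneEvenConductorAtTwo := by
  intro W _ _ c xnum xden B2 B4 B6 hc hb hs ho hodd h1 h0
  exact h W c xnum xden B2 B4 B6 hc hb hs ho
    (fun v ℓ hv hℓ => switchedOffAt_of_odd W c v ℓ (hodd v (two_not_mem_of_placeOver hv hℓ))) h1 h0

/-- Kernel glue: on a DESC-39-A curve LAW36-shape (DESC-36-E) holds with the EMPTY list. -/
theorem shapeWitness_nil_of_switchedOff (h : PureSpinLawOfSwitchedOffReductionAtTwo)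
    (W : WeierstrassCurve ℚ) [W.IsElliptic] [W.IsGloballyMinimal] (c xnum : ℤ[X]) (xden : ℕ)
    (hc : CubicDatumFor W c xnum xden) (hs : selmerTwoCard W = 1) (ho : DegOnePrimesOddClassC c)
    (hoff : ∀ (v : HeightOneSpectrum (𝓞 ℚ)) (ℓ : ℕ), PlaceOver v ℓ → SwitchedOffAt W c v ℓ) :
    ∃ ys : List ℤ[X], (∀ y ∈ ys, CorrectionElementC W c y) ∧ ys.length ≤ 3 * (W.conductorNorm ℤ).primeFactors.card ∧
      CorrectedSpinLawFits W c xnum xden ys :=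
  ⟨[], by simp, by simp, h W c xnum xden hc hs ho hoff⟩

/-- Kernel glue: the two directions are jointly consistent only if no curve satisfies both hypothesis sets — a curve with every place OFF has no ON place
(`SwitchedOnAt → ¬ SwitchedOffAt` by definition), so DESC-39-A and DESC-39-B never speak about the same curve. -/
theorem not_switchedOn_of_all_off (W : WeierstrassCurve ℚ) (c : ℤ[X])
    (hoff : ∀ (v : HeightOneSpectrum (𝓞 ℚ)) (ℓ : ℕ), PlaceOver v ℓ → SwitchedOffAt W c v ℓ)
    (v : HeightOneSpectrum (𝓞 ℚ)) (ℓ : ℕ) (hv : PlaceOver v ℓ) : ¬ SwitchedOnAt W c v ℓ :=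
  fun hon => hon.1 (hoff v ℓ hv)

end Summit.BirchSwinnertonDyer.Rank1Residual.F1Sign2

end
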